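import Literature.AnabelianGeometry.EtaleTheta.Discharge.Sec2AutKNormalizersX
import Literature.AnabelianGeometry.EtaleTheta.Discharge.Sec2BarThetaCommutator
import HarnessLib

/-!
# [EtTh] Prop. 2.2 (ii), LAST SENTENCE: the image of the inversion `ι̲` in `Δ̄_C/Δ̄_{X̲}` is THE coset
# that lifts the nontrivial element of `Gal(X/C)` and normalises `Δ̄_{X̲̲} = Im(s_ι)` (proof-only companion)

Mochizuki, *The étale theta function and its Frobenioid-theoretic manifestations* [EtTh], Publ. RIMS
**45** (2009), §2, Prop. 2.2 (ii), PRIMS PDF p. 37 (printed p. 263), last sentence: «Finally, the image of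
`ι̲` in `Δ̄_C/Δ̄_{X̲}` may be characterized as the unique coset of `Δ̄_C/Δ̄_{X̲}` that lifts the nontrivial
element of `Gal(X/C) = Δ̄_C/Δ̄_X` and normalizes the subgroup `Δ̄_{X̲̲} ⊆ Δ̄_C`» — decorations (which `Δ`
carries one underline, which two) as certified from the PRIMS PDF rule geometry by the cell's
plan/C-CLAUSES-L2-DECORATIONS.md (assertion D of EtTh:Prop2.2(ii) in plan/C-CLAUSES-L2A.md)
[cite: MochizukiEtTh2009, Prop 2.2(ii) p.37].

Cell abc-iut, layer L2, seat abc-iut-w6-d082 (gen 3; R-C discharge of node EtTh:Prop2.2(ii)). This is the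
one printed clause of Prop. 2.2 (ii) that abc-iut-L2-t2's typed statement `ThetaCovers.CoverData.Prop22_ii`
deliberately does NOT transcribe (its docstring: «the intended normalised subgroup needs the page image»;
abc-iut-w6-d082 gen 2, `Sec2Prop22iiOfCoverData`: «Not covered»). With the decorations now certified the
clause is a genuine statement — in the interface's vocabulary (everything pulled back to `Π_C`; `Ker ⊆ E`, so
"`ḡ` normalises `Ē` in `Δ̄_C`" is "`g` normalises `E` in `Π_C`"): for `X : CoverDataAx l`, `Π_{C̲} = H'` of type
`(1, l-tors)±`, an inversion `ι̲ ∈ Δ_{C̲} ∖ Π_X` and the `(−1)`-eigenspace datum `E` (`= Im(s_ι)`-preimage,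
`IsMinusEigen`) of Prop. 2.2 (i):

* `mem_of_deltaX_mem_normalizer_eigen` — an element of `Δ_X` normalising `E` lies in `Π_{X̲}`: it
  centralises `E·Δ̄_Θ = Δ_{X̲}` modulo `Ker`, so the non-degenerate commutator pairing
  (`mem_of_commutator_mem_barKer`, abc-iut-L2-d3) puts it in `Π_{X̲}` — the argument abc-iut-L2-d3 runs inside
  `normalizer_sup_eigen_le` (Rmk. 2.6.1), isolated;
* `normalizer_eigen_le` / **`normalizer_eigen_eq`** — `N_{Π_C}(E) = Π_{C̲}`;
* **`mem_normalizer_eigen_iff_of_not_mem`** — for `g ∈ Π_C ∖ Π_X` (a lift of the nontrivial element of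
  `Gal(X/C)`): `g` normalises `E` iff `ι̲⁻¹ g ∈ Π_{X̲}`; **`mem_normalizer_eigen_iff_of_lift`** — the same for
  `g ∈ Δ_C ∖ Δ_X` with `ι̲⁻¹ g ∈ Δ_{X̲} = Π_{X̲} ∩ Δ_C`, i.e. THE PRINTED SENTENCE: among the cosets of `Δ̄_{X̲}` in
  `Δ̄_C` lying over the nontrivial element of `Δ̄_C/Δ̄_X`, exactly `ι̲·Δ̄_{X̲}` normalises `Δ̄_{X̲̲}`;
* `prop22_ii_inversion_coset` — packaged in the `∃`/`∀ … ↔`-shape of abc-iut-L2-t2's `Prop22_iii`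
  (existence of the coset, its uniqueness, and «the image of `ι̲`» lies in it);
* `ThetaSetting.PiCData.prop22_ii_inversion_coset_ofSetting` — the sentence AT THE ARITHMETIC MODEL
  (abc-iut-L2-t10's `PiCData.coverDataAx`, ThetaCoversAxOfSetting p428054) with the only extra input, the
  printed definition of `Δ̄_Θ` (`hΘ : ⁅Δ_X, Δ_X⁆·Ker = Δ̄_Θ`-preimage, GAP-LEDGER G-L2d3-1), DISCHARGED there by
  abc-iut-L2-t11's `coverDataAx_hTheta` (p431249): no binder beyond those of `coverDataAx` itself.

INPUT of record beyond the Prop. 2.2 (i) data: `hΘ` (G-L2d3-1) — necessary in substance: at an abelian-`Δ̄_X`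
cover datum (`ThetaCoversAbelianWitness`) every element of `Δ_X` normalises `E`. PROOF-ONLY: no `def`, no new
named `Prop` fact, nothing of another seat edited or restated; nothing asserts that a `CoverDataAx` or a theta
setting exists; [EtTh] is refereed; no side is taken on [IUTchIII] Cor. 3.12; typed ≠ proved elsewhere.
-/

namespace Literature.AnabelianGeometry.EtaleTheta

namespace ThetaCovers

namespace CoverDataAx

open scoped commutatorElement

universe u

variable {l : ℕ} (X : CoverDataAx.{u} l)

section Data

variable {H' E : Subgroup X.PiC} {ι : X.PiC}

/-! ### `N_{Π_C}(Im(s_ι)) = Π_{C̲}` -/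

/-- An element `a ∈ Δ_X` that normalises the eigenspace `E = Im(s_ι)`-preimage lies in `Π_{X̲} = Π_{C̲} ∩ Π_X`:
for `e ∈ E`, `⁅a, e⁆ ∈ E ∩ Δ̄_Θ`-preimage `= Ker`, and `Δ̄_Θ` is central, so `a` centralises `Δ_{X̲} = E·Δ̄_Θ`-preimage
modulo `Ker`; by the non-degeneracy of the commutator pairing on `Δ̄^ell_X` (printed definition of `Δ̄_Θ`, `hΘ`)
this forces `a ∈ Π_{X̲}`. [cite: MochizukiEtTh2009, Prop 2.2(ii) p.37] -/
theorem mem_of_deltaX_mem_normalizer_eigen (hΘ : ⁅X.DeltaX, X.DeltaX⁆ ⊔ X.barKer = X.barTheta)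
    (hH' : X.toCoverData.IsTypeLTorsPm H') (hE : X.toCoverData.IsMinusEigen (H' ⊓ X.PiX) H' ι E)
    {a : X.PiC} (ha : a ∈ X.DeltaX)
    (haE : a ∈ Subgroup.normalizer ((E : Subgroup X.PiC) : Set X.PiC)) : a ∈ H' ⊓ X.PiX := by
  haveI := X.PiX_normal
  haveI : X.DeltaX.Normal := inferInstance
  haveI := X.barTheta_normal
  haveI := X.barKer_normal
  have hT := hH'.inf_isTypeLTors
  -- `a` commutes with `Δ_{X̲} = E·Δ̄_Θ` modulo `Ker`
  have hcomm : ∀ d : X.PiC, d ∈ H' ⊓ X.PiX → d ∈ X.DeltaX → ⁅a, d⁆ ∈ X.barKer := by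
    intro d hdH hdΔ
    have hd : d ∈ E ⊔ X.barTheta := by rw [hE.sup_eq]; exact ⟨hdH, hdΔ.2⟩
    obtain ⟨e, he, t, ht, rfl⟩ := Subgroup.mem_sup_of_normal_right.mp hd
    have hae : ⁅a, e⁆ ∈ X.barKer := by
      rw [← hE.inf_eq]
      refine ⟨?_, X.commutator_deltaX_le_barTheta (Subgroup.commutator_mem_commutator ha
        ⟨hT.le (hE.le he).1, (hE.le he).2⟩)⟩
      rw [commutatorElement_def]
      exact Subgroup.mul_mem _ ((Subgroup.mem_normalizer_iff.mp haE e).mp he) (Subgroup.inv_mem _ he)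
    have heΔ : e ∈ X.DeltaX := ⟨hT.le (hE.le he).1, (hE.le he).2⟩
    rw [← QuotientGroup.eq_one_iff, ClassTwo.mk_commutator_mul_right X.DeltaX X.barTheta X.barKer
      X.commutator_deltaX_le_barTheta X.commutator_deltaX_barTheta_le_barKer ha heΔ (X.barTheta_le ht),
      (QuotientGroup.eq_one_iff _).mpr hae, one_mul, X.mk_commutator_barTheta_right ha ht]
  exact X.mem_of_commutator_mem_barKer hΘ hT ha hcomm

/-- `N_{Π_C}(E) ⊆ Π_{C̲}`: write a normaliser `g` as `y·a` with `y ∈ Π_{C̲}` (which normalises `E`, Prop. 2.2 (i))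
and `a ∈ Δ_X` (`Π_{C̲}·Δ_X = Π_C`); then `a` normalises `E`, hence `a ∈ Π_{X̲}`.
[cite: MochizukiEtTh2009, Prop 2.2(ii) p.37] -/
theorem normalizer_eigen_le (hΘ : ⁅X.DeltaX, X.DeltaX⁆ ⊔ X.barKer = X.barTheta)
    (hH' : X.toCoverData.IsTypeLTorsPm H') (hι : X.toCoverData.IsInversion H' ι)
    (hE : X.toCoverData.IsMinusEigen (H' ⊓ X.PiX) H' ι E) :
    Subgroup.normalizer ((E : Subgroup X.PiC) : Set X.PiC) ≤ H' := by
  haveI := X.PiX_normal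
  haveI : X.DeltaX.Normal := inferInstance
  intro g hg
  have hg' : g ∈ H' ⊔ X.DeltaX := by rw [X.sup_deltaX_eq_top hH' hι]; exact Subgroup.mem_top g
  obtain ⟨y, hy, a, ha, rfl⟩ := Subgroup.mem_sup_of_normal_right.mp hg'
  have hyE := X.le_normalizer_eigen hι hE hy
  have haE : a ∈ Subgroup.normalizer ((E : Subgroup X.PiC) : Set X.PiC) := by
    have := Subgroup.mul_mem _ (Subgroup.inv_mem _ hyE) hg
    rwa [inv_mul_cancel_left] at this
  exact Subgroup.mul_mem _ hy (X.mem_of_deltaX_mem_normalizer_eigen hΘ hH' hE ha haE).1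

/-- **`N_{Π_C}(Im(s_ι)) = Π_{C̲}`**: the normaliser in `Π_C` of the `(−1)`-eigenspace datum `E` of Prop. 2.2 (i)
is exactly `Π_{C̲}` (under the printed definition of `Δ̄_Θ`). [cite: MochizukiEtTh2009, Prop 2.2(ii) p.37] -/
theorem normalizer_eigen_eq (hΘ : ⁅X.DeltaX, X.DeltaX⁆ ⊔ X.barKer = X.barTheta)
    (hH' : X.toCoverData.IsTypeLTorsPm H') (hι : X.toCoverData.IsInversion H' ι)
    (hE : X.toCoverData.IsMinusEigen (H' ⊓ X.PiX) H' ι E) :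
    Subgroup.normalizer ((E : Subgroup X.PiC) : Set X.PiC) = H' :=
  le_antisymm (X.normalizer_eigen_le hΘ hH' hι hE) (X.le_normalizer_eigen hι hE)

/-! ### The printed sentence: the coset of `Δ̄_{X̲}` over the nontrivial element of `Gal(X/C)` normalising `Δ̄_{X̲̲}` -/

/-- For a lift `g ∈ Π_C ∖ Π_X` of the nontrivial element of `Gal(X/C) = Π_C/Π_X`: `g` normalises `E = Im(s_ι)`-preimage
iff `ι̲⁻¹·g ∈ Π_{X̲}`, i.e. iff `g ∈ ι̲·Π_{X̲}`. [cite: MochizukiEtTh2009, Prop 2.2(ii) p.37] -/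
theorem mem_normalizer_eigen_iff_of_not_mem (hΘ : ⁅X.DeltaX, X.DeltaX⁆ ⊔ X.barKer = X.barTheta)
    (hH' : X.toCoverData.IsTypeLTorsPm H') (hι : X.toCoverData.IsInversion H' ι)
    (hE : X.toCoverData.IsMinusEigen (H' ⊓ X.PiX) H' ι E) {g : X.PiC} (hgX : g ∉ X.PiX) :
    g ∈ Subgroup.normalizer ((E : Subgroup X.PiC) : Set X.PiC) ↔ ι⁻¹ * g ∈ H' ⊓ X.PiX := by
  have hιinv : ι⁻¹ ∉ X.PiX := fun h => hι.not_mem ((Subgroup.inv_mem_iff _).mp h)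
  have hιg : ι⁻¹ * g ∈ X.PiX := (Subgroup.mul_mem_iff_of_index_two X.index_PiX).mpr (iff_of_false hιinv hgX)
  constructor
  · intro hg
    exact ⟨Subgroup.mul_mem _ (Subgroup.inv_mem _ hι.mem) (X.normalizer_eigen_le hΘ hH' hι hE hg), hιg⟩
  · intro hg
    have e1 : g = ι * (ι⁻¹ * g) := by group
    rw [e1]
    exact X.le_normalizer_eigen hι hE (Subgroup.mul_mem _ hι.mem hg.1)

/-- **Prop. 2.2 (ii), last sentence, literally**: for `g ∈ Δ_C ∖ Δ_X` (a lift in `Δ_C` of the nontrivial element of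
`Gal(X/C) = Δ̄_C/Δ̄_X`), `g` normalises `Δ̄_{X̲̲} = Im(s_ι)` iff `ι̲⁻¹·g ∈ Δ_{X̲} = Π_{X̲} ∩ Δ_C` — i.e. the cosets of `Δ̄_{X̲}`
in `Δ̄_C` over the nontrivial element of `Δ̄_C/Δ̄_X` that normalise `Δ̄_{X̲̲}` are exactly one, `ι̲·Δ̄_{X̲}`.
[cite: MochizukiEtTh2009, Prop 2.2(ii) p.37] -/
theorem mem_normalizer_eigen_iff_of_lift (hΘ : ⁅X.DeltaX, X.DeltaX⁆ ⊔ X.barKer = X.barTheta)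
    (hH' : X.toCoverData.IsTypeLTorsPm H') (hι : X.toCoverData.IsInversion H' ι)
    (hE : X.toCoverData.IsMinusEigen (H' ⊓ X.PiX) H' ι E) {g : X.PiC} (hgC : g ∈ X.DeltaC)
    (hgX : g ∉ X.PiX) :
    g ∈ Subgroup.normalizer ((E : Subgroup X.PiC) : Set X.PiC) ↔ ι⁻¹ * g ∈ (H' ⊓ X.PiX) ⊓ X.DeltaC := by
  rw [X.mem_normalizer_eigen_iff_of_not_mem hΘ hH' hι hE hgX]
  have hιgC : ι⁻¹ * g ∈ X.DeltaC := Subgroup.mul_mem _ (Subgroup.inv_mem _ hι.mem_delta) hgC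
  exact ⟨fun h => ⟨h, hιgC⟩, fun h => h.1⟩

/-- **Prop. 2.2 (ii), last sentence, packaged** (the `∃`/`∀ … ↔` shape of abc-iut-L2-t2's `Prop22_iii`): there is a
lift `g₀ ∈ Δ_C ∖ Δ_X` of the nontrivial element of `Gal(X/C)` normalising `E`, a lift `g` normalises `E` iff
`g ∈ g₀·Δ_{X̲}` (so the normalising lifts form ONE coset of `Δ̄_{X̲}`), and the image of `ι̲` lies in that coset.
[cite: MochizukiEtTh2009, Prop 2.2(ii) p.37] -/
theorem prop22_ii_inversion_coset (hΘ : ⁅X.DeltaX, X.DeltaX⁆ ⊔ X.barKer = X.barTheta)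
    (hH' : X.toCoverData.IsTypeLTorsPm H') (hι : X.toCoverData.IsInversion H' ι)
    (hE : X.toCoverData.IsMinusEigen (H' ⊓ X.PiX) H' ι E) :
    ∃ g₀ : X.PiC, (g₀ ∈ X.DeltaC ∧ g₀ ∉ X.PiX ∧ g₀ ∈ Subgroup.normalizer ((E : Subgroup X.PiC) : Set X.PiC)) ∧
      (∀ g : X.PiC, g ∈ X.DeltaC → g ∉ X.PiX →
        (g ∈ Subgroup.normalizer ((E : Subgroup X.PiC) : Set X.PiC) ↔ g₀⁻¹ * g ∈ (H' ⊓ X.PiX) ⊓ X.DeltaC)) ∧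
      g₀⁻¹ * ι ∈ (H' ⊓ X.PiX) ⊓ X.DeltaC := by
  refine ⟨ι, ⟨hι.mem_delta, hι.not_mem, X.le_normalizer_eigen hι hE hι.mem⟩,
    fun g hgC hgX => X.mem_normalizer_eigen_iff_of_lift hΘ hH' hι hE hgC hgX, ?_⟩
  rw [inv_mul_cancel]
  exact Subgroup.one_mem _

end Data

end CoverDataAx

end ThetaCovers

/-! ### At the arithmetic model (abc-iut-L2-t10's `PiCData.coverDataAx`): `hΘ` discharged by `coverDataAx_hTheta` -/

namespace ThetaSetting

namespace PiCData

open Literature.AnabelianGeometry.SemiGraphs ThetaCovers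

variable {p : ℕ} [Fact p.Prime] {D : ThetaSetting p} {PiC : Type} [Group PiC] [TopologicalSpace PiC]
  [IsTopologicalGroup PiC] [T2Space PiC] (I : D.PiCData PiC) (l : ℕ)

/-- **Prop. 2.2 (ii), last sentence, AT THE ARITHMETIC MODEL**: for the `CoverDataAx` of an [EtTh] §1 theta setting
(abc-iut-L2-t10's `PiCData.coverDataAx`, binders as there: the input bundle `I`, `e`, a cusp `x`, P-C3 `hIx`,
P-C4 `hιell`/`hιtheta`) and ANY `Π_{C̲} = H'` of type `(1, l-tors)±`, inversion `ι̲`, eigenspace datum `E`: the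
normalising lifts of the nontrivial element of `Gal(X/C)` form the single coset `ι̲·Δ_{X̲}` — the printed
definition of `Δ̄_Θ` (`hΘ`, G-L2d3-1) being a THEOREM here (abc-iut-L2-t11's `coverDataAx_hTheta`).
[cite: MochizukiEtTh2009, Prop 2.2(ii) p.37] -/
theorem prop22_ii_inversion_coset_ofSetting (e : D.OncePuncturedData) {x : D.Pt} (hx : D.IsCusp x)
    (hodd : Odd l) (hIx : (I.Dx x ⊓ I.augGK.ker) ⊔ I.barKer l = I.barTheta l)
    (hιell : ∀ c ∈ I.augGK.ker, c ∉ I.PiX → ∀ d ∈ I.PiX ⊓ I.augGK.ker, c * d * c⁻¹ * d ∈ I.barTheta l)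
    (hιtheta : ∀ c ∈ I.augGK.ker, c ∉ I.PiX → ∀ t ∈ I.barTheta l, c * t * c⁻¹ * t⁻¹ ∈ I.barKer l)
    {H' E : Subgroup (I.coverDataAx l e hx hodd hIx hιell hιtheta).PiC}
    {ι : (I.coverDataAx l e hx hodd hIx hιell hιtheta).PiC}
    (hH' : (I.coverDataAx l e hx hodd hIx hιell hιtheta).toCoverData.IsTypeLTorsPm H')
    (hι : (I.coverDataAx l e hx hodd hIx hιell hιtheta).toCoverData.IsInversion H' ι)
    (hE : (I.coverDataAx l e hx hodd hIx hιell hιtheta).toCoverData.IsMinusEigen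
      (H' ⊓ (I.coverDataAx l e hx hodd hIx hιell hιtheta).PiX) H' ι E) :
    ∀ g : (I.coverDataAx l e hx hodd hIx hιell hιtheta).PiC,
      g ∈ (I.coverDataAx l e hx hodd hIx hιell hιtheta).toCoverData.DeltaC →
      g ∉ (I.coverDataAx l e hx hodd hIx hιell hιtheta).PiX →
      (g ∈ Subgroup.normalizer ((E : Subgroup (I.coverDataAx l e hx hodd hIx hιell hιtheta).PiC) :
          Set (I.coverDataAx l e hx hodd hIx hιell hιtheta).PiC) ↔
        ι⁻¹ * g ∈ (H' ⊓ (I.coverDataAx l e hx hodd hIx hιell hιtheta).PiX) ⊓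
          (I.coverDataAx l e hx hodd hIx hιell hιtheta).toCoverData.DeltaC) :=
  fun _ hgC hgX => (I.coverDataAx l e hx hodd hIx hιell hιtheta).mem_normalizer_eigen_iff_of_lift
    (I.coverDataAx_hTheta l e hx hodd hIx hιell hιtheta) hH' hι hE hgC hgX

end PiCData

end ThetaSetting

end Literature.AnabelianGeometry.EtaleTheta
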